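import Literature.MathematicalPhysics.QuantumFieldTheory.Balaban1983to89.T4AveragingDeficitNonAbelian

/-!
# AveragingDeficitCounting (T⁴ programme, node NE3, row NE3-R2) — lattice bookkeeping for the assembly of the
# derivative wall β from per-plaquette estimates: `ℓ^∞` boxes and neighbourhoods of `ℤ^d`, the block decomposition
# `x = L•y + r`, double counting of box sums and of stencil sums against a neighbourhood sum

HONEST FRAMING (cell `pub-balaban`; unit `b2b-balaban-t4-ne3r2-p1`, owner of BINDER-OWNERS row NE3-R2).  Pure lattice
combinatorics on `ℤ^d` ([folklore]); no analysis, no paper statement, nothing about minimisers, NE3, BetaPertH or Clay.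
It serves `AveragingDeficitDerivAssembly`, which reduces β = `T4AveragingDeficitWall.DeficitDerivWall` to a per-coarse-
plaquette estimate: there the window sums of β are re-indexed by coarse sites `y` (blocks `B(Ly)`, B5 (1.6)) and stencils
(`T4AveragingDeficitWallBoundary.stencilIdx/stencilOff`: the `L^{d+2}` fine plaquettes `Ly + r + ie_μ + je_ν` of the coarse
plaquette at `Ly` in the plane `(μ,ν)`), and the local right-hand sides (sums over `ℓ^∞` boxes `box R (Ly)` of
`T4AveragingDeficitWall`) must be dominated by ONE sum over the neighbourhood `nbhd R (bondSites S)` of the support.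
WHAT IS PROVED.  §1 membership / monotonicity of `box`, `nbhd` (`mem_box_iff`, `mem_nbhd_iff`, `box_mono`, `nbhd_mono`,
`box_subset_box_of_mem`, `box_subset_nbhd`, `card_box_eq`).  §2 the block decomposition (`blockIdx`, `blockRem`,
`block_decomp`, `blockIdx_smul`, `abs_sub_smul_blockIdx_le`, `mem_blockSites_of`).  §3 double counting:
`sum_box_sum_le` (`Σ_{y∈Y} Σ_{x∈box R(Ly)} g x ≤ (2R+1)^d · Σ_{x∈N} g x` for `g ≥ 0` when all the boxes lie in `N`),
`sum_stencil_sum_le` (`Σ_{y∈Y} Σ_{k∈stencil} g(Ly + off k) ≤ L² · Σ_{x∈N} g x` when the shifted block sites lie in `N`),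
`sum_stencil_sum_eq` (EQUALITY for a `g` whose support, shifted back by the `L²` in-plane offsets, lies in the block sites
of `Y` — the exact `L²`-fold covering used to cancel the fine main term); Cauchy–Schwarz is Mathlib's
`Real.sum_mul_le_sqrt_mul_sqrt` / `sq_sum_le_card_mul_sum_sq`.
Context citation for the block geometry: T. Bałaban, Commun. Math. Phys. **95** (1984) 17–40 [Balaban1984PropagatorsI],
(1.6) p. 18 (blocks) — a DEFINITION transcribed by the tree (`T4AveragingDeficitWall.block`), not a hypothesis.
PLACEMENT: new cell work under `Summits/QuantumFields/BalabanUV/` (human rule 2026-08-19).  Record: HOME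
`t4/T4-EST-NE3-R2.md`.
-/

set_option autoImplicit false

open scoped BigOperators
open Finset

namespace Summit.QuantumFields.BalabanUV.T4Continuum.AveragingDeficitCounting

open Literature.MathematicalPhysics.QuantumFieldTheory.Balaban1983to89
open B7Prop1Explicit (boxVec e)
open T4AveragingDeficitWall (box nbhd block blockSites)
open T4AveragingDeficitWallBoundary (stencilIdx stencilOff card_stencilIdx sum_blocks_eq blockSites_eq_image
  blockMap_injective)

noncomputable section

variable {d : ℕ}

local notation "Site" => B7Prop1Explicit.Site

/-! ## §1 Boxes and neighbourhoods -/

/-- `x ∈ box R y ↔ ∀ κ, |x κ − y κ| ≤ R`. [folklore] -/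
theorem mem_box_iff {R : ℕ} {x y : Site d} : x ∈ box R y ↔ ∀ κ, |x κ - y κ| ≤ (R : ℤ) := by
  unfold T4AveragingDeficitWall.box
  rw [Finset.mem_Icc, Pi.le_def, Pi.le_def, ← forall_and]
  refine forall_congr' fun κ => ?_
  simp only [Pi.sub_apply, Pi.add_apply, abs_le]
  constructor
  · rintro ⟨h1, h2⟩; constructor <;> linarith
  · rintro ⟨h1, h2⟩; constructor <;> linarith

/-- `x ∈ nbhd R T ↔ ∃ t ∈ T, x ∈ box R t`. [folklore] -/
theorem mem_nbhd_iff {R : ℕ} {T : Finset (Site d)} {x : Site d} : x ∈ nbhd R T ↔ ∃ t ∈ T, x ∈ box R t := by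
  unfold T4AveragingDeficitWall.nbhd
  rw [Finset.mem_biUnion]

/-- The centre lies in its box. [folklore] -/
theorem self_mem_box (R : ℕ) (y : Site d) : y ∈ box R y :=
  mem_box_iff.mpr fun κ => by simp

/-- Box membership is symmetric. [folklore] -/
theorem mem_box_comm {R : ℕ} {x y : Site d} : x ∈ box R y ↔ y ∈ box R x := by
  simp only [mem_box_iff, abs_sub_comm]

/-- Boxes grow with the radius. [folklore] -/
theorem box_mono {R R' : ℕ} (h : R ≤ R') (y : Site d) : box R y ⊆ box R' y := fun x hx =>
  mem_box_iff.mpr fun κ => (mem_box_iff.mp hx κ).trans (by exact_mod_cast h)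

/-- Neighbourhoods grow with the radius. [folklore] -/
theorem nbhd_mono {R R' : ℕ} (h : R ≤ R') (T : Finset (Site d)) : nbhd R T ⊆ nbhd R' T := fun x hx => by
  obtain ⟨t, ht, hxt⟩ := mem_nbhd_iff.mp hx
  exact mem_nbhd_iff.mpr ⟨t, ht, box_mono h t hxt⟩

/-- Triangle inequality for boxes: `x ∈ box R₁ t` ⇒ `box R₂ x ⊆ box (R₁ + R₂) t`. [folklore] -/
theorem box_subset_box_of_mem {R₁ R₂ : ℕ} {x t : Site d} (hx : x ∈ box R₁ t) : box R₂ x ⊆ box (R₁ + R₂) t := by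
  intro z hz
  rw [mem_box_iff] at hx hz ⊢
  intro κ
  have h1 := hx κ; have h2 := hz κ
  have := abs_sub_le (z κ) (x κ) (t κ)
  push_cast
  linarith

/-- `x ∈ nbhd R₁ T` ⇒ `box R₂ x ⊆ nbhd (R₁ + R₂) T`. [folklore] -/
theorem box_subset_nbhd {R₁ R₂ : ℕ} {T : Finset (Site d)} {x : Site d} (hx : x ∈ nbhd R₁ T) :
    box R₂ x ⊆ nbhd (R₁ + R₂) T := by
  obtain ⟨t, ht, hxt⟩ := mem_nbhd_iff.mp hx
  intro z hz
  exact mem_nbhd_iff.mpr ⟨t, ht, box_subset_box_of_mem hxt hz⟩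

/-- `x ∈ nbhd R₁ T`, `z ∈ box R₂ x` ⇒ `z ∈ nbhd (R₁ + R₂) T`. [folklore] -/
theorem mem_nbhd_of_mem_box {R₁ R₂ : ℕ} {T : Finset (Site d)} {x z : Site d} (hx : x ∈ nbhd R₁ T)
    (hz : z ∈ box R₂ x) : z ∈ nbhd (R₁ + R₂) T :=
  box_subset_nbhd hx hz

/-- A site of `T` lies in every neighbourhood of `T`. [folklore] -/
theorem mem_nbhd_self {R : ℕ} {T : Finset (Site d)} {t : Site d} (ht : t ∈ T) : t ∈ nbhd R T :=
  mem_nbhd_iff.mpr ⟨t, ht, self_mem_box R t⟩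

/-- `#box R y = (2R+1)^d`. [folklore] -/
theorem card_box_eq (R : ℕ) (y : Site d) : (box R y).card = (2 * R + 1) ^ d := by
  unfold T4AveragingDeficitWall.box
  rw [Pi.card_Icc]
  simp only [Pi.sub_apply, Pi.add_apply, Int.card_Icc]
  have h : ∀ κ : Fin d, (y κ + (R : ℤ) + 1 - (y κ - (R : ℤ))).toNat = 2 * R + 1 := fun κ => by omega
  simp only [h, Finset.prod_const, Finset.card_univ, Fintype.card_fin]

/-! ## §2 The block decomposition `x = L•y + r`, `r ∈ [0,L)^d` -/

/-- The block index `⌊x/L⌋` (coordinatewise). [folklore] -/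
def blockIdx (L : ℕ) (x : Site d) : Site d := fun κ => x κ / (L : ℤ)

/-- The in-block remainder `x mod L ∈ [0,L)^d`. [folklore] -/
def blockRem (L : ℕ) (hL : 1 ≤ L) (x : Site d) : Fin d → Fin L := fun κ =>
  ⟨(x κ % (L : ℤ)).toNat, by
    have h0 : (0 : ℤ) < L := by exact_mod_cast hL
    have h1 : x κ % (L : ℤ) < L := Int.emod_lt_of_pos _ h0
    have h2 : 0 ≤ x κ % (L : ℤ) := Int.emod_nonneg _ h0.ne'
    omega⟩

/-- `x = L•⌊x/L⌋ + (x mod L)`. [cite: Balaban1984PropagatorsI, (1.6) p.18] -/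
theorem block_decomp (L : ℕ) (hL : 1 ≤ L) (x : Site d) :
    x = (L : ℤ) • blockIdx L x + boxVec L (blockRem L hL x) := by
  funext κ
  have h0 : (0 : ℤ) < L := by exact_mod_cast hL
  simp only [Pi.add_apply, Pi.smul_apply, smul_eq_mul, blockIdx, boxVec, blockRem]
  rw [Int.toNat_of_nonneg (Int.emod_nonneg _ h0.ne'), Int.emod_def]
  ring

/-- `⌊(L•y)/L⌋ = y`. [folklore] -/
theorem blockIdx_smul (L : ℕ) (hL : 1 ≤ L) (y : Site d) : blockIdx L ((L : ℤ) • y) = y := by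
  funext κ
  have h0 : (L : ℤ) ≠ 0 := by exact_mod_cast (by omega : L ≠ 0)
  simp only [blockIdx, Pi.smul_apply, smul_eq_mul]
  exact Int.mul_ediv_cancel_left _ h0

/-- `|x κ − L·⌊x/L⌋ κ| ≤ L − 1`: a site is within `ℓ^∞`-distance `L − 1` of its block base. [folklore] -/
theorem mem_box_blockBase (L : ℕ) (hL : 1 ≤ L) (x : Site d) : x ∈ box (L - 1) ((L : ℤ) • blockIdx L x) := by
  rw [mem_box_iff]
  intro κ
  have h0 : (0 : ℤ) < L := by exact_mod_cast hL
  simp only [Pi.smul_apply, smul_eq_mul, blockIdx]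
  have h1 : x κ % (L : ℤ) < L := Int.emod_lt_of_pos _ h0
  have h2 : 0 ≤ x κ % (L : ℤ) := Int.emod_nonneg _ h0.ne'
  have h3 : x κ - L * (x κ / L) = x κ % L := by rw [Int.emod_def]
  rw [h3, abs_of_nonneg h2]
  have : ((L - 1 : ℕ) : ℤ) = (L : ℤ) - 1 := by omega
  omega

/-- A site lies in the block sites of any `Y` containing its block index. [folklore] -/
theorem mem_blockSites_of (L : ℕ) (hL : 1 ≤ L) {Y : Finset (Site d)} {x : Site d} (h : blockIdx L x ∈ Y) :
    x ∈ blockSites L Y := by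
  rw [blockSites_eq_image, Finset.mem_image]
  exact ⟨(blockIdx L x, blockRem L hL x), Finset.mem_product.mpr ⟨h, Finset.mem_univ _⟩, (block_decomp L hL x).symm⟩

/-- Block sites of `Y` have block index in `Y`. [folklore] -/
theorem blockIdx_mem_of_mem_blockSites (L : ℕ) (hL : 1 ≤ L) {Y : Finset (Site d)} {x : Site d}
    (h : x ∈ blockSites L Y) : blockIdx L x ∈ Y := by
  rw [blockSites_eq_image, Finset.mem_image] at h
  obtain ⟨⟨y, r⟩, hyr, rfl⟩ := h
  have hy : y ∈ Y := (Finset.mem_product.mp hyr).1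
  have : blockIdx L ((L : ℤ) • y + boxVec L r) = y := by
    funext κ
    have h0 : (L : ℤ) ≠ 0 := by exact_mod_cast (by omega : L ≠ 0)
    have h0' : (0 : ℤ) < L := by exact_mod_cast hL
    simp only [blockIdx, Pi.add_apply, Pi.smul_apply, smul_eq_mul, boxVec]
    rw [add_comm, Int.add_mul_ediv_left _ _ h0, Int.ediv_eq_zero_of_lt (by positivity) (by exact_mod_cast (r κ).isLt),
      zero_add]
  rwa [this]

/-- A block site of `{y}`-type: `L•y + r` is within `ℓ^∞`-distance `L − 1` of `L•y`. [folklore] -/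
theorem smul_add_boxVec_mem_box (L : ℕ) (hL : 1 ≤ L) (y : Site d) (r : Fin d → Fin L) :
    (L : ℤ) • y + boxVec L r ∈ box (L - 1) ((L : ℤ) • y) := by
  rw [mem_box_iff]
  intro κ
  simp only [Pi.add_apply, Pi.smul_apply, smul_eq_mul, boxVec, add_sub_cancel_left]
  rw [abs_of_nonneg (by positivity)]
  have := (r κ).isLt
  have : ((L - 1 : ℕ) : ℤ) = (L : ℤ) - 1 := by omega
  omega

/-- The stencil corner `Ly + r + ie_μ + je_ν` (`r ∈ [0,L)^d`, `i,j < L`) is within `ℓ^∞`-distance `3L` of `Ly`.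
[folklore] -/
theorem stencil_corner_mem_box (L : ℕ) (y : Site d) (μ ν : Fin d) {k : (Fin d → Fin L) × (ℕ × ℕ)}
    (hk : k ∈ stencilIdx d L) : (L : ℤ) • y + stencilOff L μ ν k ∈ box (3 * L) ((L : ℤ) • y) := by
  rw [mem_box_iff]
  intro κ
  have hi : k.2.1 < L := by
    have := (Finset.mem_product.mp (Finset.mem_product.mp hk).2).1; simpa using this
  have hj : k.2.2 < L := by
    have := (Finset.mem_product.mp (Finset.mem_product.mp hk).2).2; simpa using this
  have hr := (k.1 κ).isLt
  simp only [stencilOff, Pi.add_apply, Pi.smul_apply, smul_eq_mul, boxVec, add_sub_cancel_left, B7Prop1Explicit.e_apply]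
  split_ifs <;> push_cast <;> rw [abs_le] <;> constructor <;> nlinarith

/-! ## §3 Double counting -/

/-- The number of coarse sites `y ∈ Y` whose `R`-box around `Ly` contains a given `x` is at most `(2R+1)^d`
(`y ↦ Ly` is injective into `box R x`). [folklore] -/
theorem card_filter_box_le (L : ℕ) (hL : 1 ≤ L) (R : ℕ) (Y : Finset (Site d)) (x : Site d) :
    (Y.filter fun y => x ∈ box R ((L : ℤ) • y)).card ≤ (2 * R + 1) ^ d := by
  rw [← card_box_eq R x]
  refine Finset.card_le_card_of_injOn (fun y => (L : ℤ) • y) (fun y hy => ?_) ?_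
  · rw [Finset.mem_coe, Finset.mem_filter] at hy
    exact mem_box_comm.mp hy.2
  · intro y _ y' _ h
    have h0 : (L : ℤ) ≠ 0 := by exact_mod_cast (by omega : L ≠ 0)
    funext κ
    have := congr_fun h κ
    simp only [Pi.smul_apply, smul_eq_mul] at this
    exact mul_left_cancel₀ h0 this

/-- **DOUBLE COUNTING OF BOX SUMS**: for `g ≥ 0` and boxes all contained in `N`,
`Σ_{y∈Y} Σ_{x∈box R (Ly)} g x ≤ (2R+1)^d · Σ_{x∈N} g x`. [folklore] -/
theorem sum_box_sum_le (L : ℕ) (hL : 1 ≤ L) (R : ℕ) (Y N : Finset (Site d)) (g : Site d → ℝ) (hg : ∀ x, 0 ≤ g x)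
    (hN : ∀ y ∈ Y, box R ((L : ℤ) • y) ⊆ N) :
    ∑ y ∈ Y, ∑ x ∈ box R ((L : ℤ) • y), g x ≤ (2 * R + 1) ^ d * ∑ x ∈ N, g x := by
  classical
  have e1 : ∑ y ∈ Y, ∑ x ∈ box R ((L : ℤ) • y), g x
      = ∑ x ∈ N, ∑ y ∈ Y.filter (fun y => x ∈ box R ((L : ℤ) • y)), g x := by
    refine Finset.sum_comm' fun y x => ?_
    simp only [Finset.mem_filter]
    constructor
    · rintro ⟨hy, hx⟩; exact ⟨⟨hy, hx⟩, hN y hy hx⟩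
    · rintro ⟨⟨hy, hx⟩, _⟩; exact ⟨hy, hx⟩
  rw [e1, Finset.mul_sum]
  refine Finset.sum_le_sum fun x _ => ?_
  rw [Finset.sum_const, nsmul_eq_mul]
  exact mul_le_mul_of_nonneg_right (by exact_mod_cast card_filter_box_le L hL R Y x) (hg x)

/-- **STENCIL SUMS AGAINST A NEIGHBOURHOOD SUM**: for `g ≥ 0`, if every in-plane shift `x + ie_μ + je_ν` (`i,j<L`) of
every block site `x` of `Y` lies in `N`, then `Σ_{y∈Y} Σ_{k∈stencil} g(Ly + off k) ≤ L² · Σ_{x∈N} g x` (each fine site is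
hit at most `L²` times: the block map is injective). [folklore] -/
theorem sum_stencil_sum_le (L : ℕ) (hL : 1 ≤ L) (Y N : Finset (Site d)) (g : Site d → ℝ) (hg : ∀ x, 0 ≤ g x)
    (μ ν : Fin d)
    (hN : ∀ x ∈ blockSites L Y, ∀ i ∈ Finset.range L, ∀ j ∈ Finset.range L,
      x + (i : ℤ) • e μ + (j : ℤ) • e ν ∈ N) :
    ∑ y ∈ Y, ∑ k ∈ stencilIdx d L, g ((L : ℤ) • y + stencilOff L μ ν k) ≤ (L : ℝ) ^ 2 * ∑ x ∈ N, g x := by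
  classical
  -- flatten the stencil block by block: `Σ_y Σ_k = Σ_{x ∈ blockSites} Σ_i Σ_j g(x + ie_μ + je_ν)`
  have e1 : ∑ y ∈ Y, ∑ k ∈ stencilIdx d L, g ((L : ℤ) • y + stencilOff L μ ν k)
      = ∑ x ∈ blockSites L Y, ∑ i ∈ Finset.range L, ∑ j ∈ Finset.range L,
          g (x + (i : ℤ) • e μ + (j : ℤ) • e ν) := by
    rw [← sum_blocks_eq L hL Y (fun x => ∑ i ∈ Finset.range L, ∑ j ∈ Finset.range L,
      g (x + (i : ℤ) • e μ + (j : ℤ) • e ν))]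
    refine Finset.sum_congr rfl fun y _ => ?_
    rw [T4AveragingDeficitNonAbelian.sum_stencil_eq L g ((L : ℤ) • y) μ ν]
  have e2 : ∑ x ∈ blockSites L Y, ∑ i ∈ Finset.range L, ∑ j ∈ Finset.range L,
        g (x + (i : ℤ) • e μ + (j : ℤ) • e ν)
      = ∑ i ∈ Finset.range L, ∑ j ∈ Finset.range L, ∑ x ∈ blockSites L Y,
          g (x + (i : ℤ) • e μ + (j : ℤ) • e ν) := by
    rw [Finset.sum_comm]
    exact Finset.sum_congr rfl fun i _ => Finset.sum_comm
  rw [e1, e2]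
  -- each inner sum is a sum of `g` over an injective image inside `N`
  have e3 : ∀ i ∈ Finset.range L, ∀ j ∈ Finset.range L,
      ∑ x ∈ blockSites L Y, g (x + (i : ℤ) • e μ + (j : ℤ) • e ν) ≤ ∑ x ∈ N, g x := by
    intro i hi j hj
    rw [← Finset.sum_image (s := blockSites L Y) (g := fun x => x + (i : ℤ) • e μ + (j : ℤ) • e ν) (f := g)
      (fun x _ x' _ h => by simpa using h)]
    refine Finset.sum_le_sum_of_subset_of_nonneg (fun z hz => ?_) fun _ _ _ => hg _
    obtain ⟨x, hx, rfl⟩ := Finset.mem_image.mp hz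
    exact hN x hx i hi j hj
  calc _ ≤ ∑ _i ∈ Finset.range L, ∑ _j ∈ Finset.range L, ∑ x ∈ N, g x :=
        Finset.sum_le_sum fun i hi => Finset.sum_le_sum fun j hj => e3 i hi j hj
    _ = (L : ℝ) ^ 2 * ∑ x ∈ N, g x := by
        rw [Finset.sum_const, Finset.sum_const, Finset.card_range, nsmul_eq_mul, nsmul_eq_mul]; ring

/-- **THE EXACT `L²`-FOLD COVERING**: if `g` vanishes off `T`, and every in-plane back-shift `x − ie_μ − je_ν`
(`i,j<L`) of every `x ∈ T` is a block site of `Y`, then `Σ_{y∈Y} Σ_{k∈stencil} g(Ly + off k) = L² · Σ_{x∈T} g x` (every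
fine site of `T` is hit EXACTLY `L²` times).  This is the counting behind the exact cancellation of the fine main term
against the stencil-diagonal of the coarse one. [folklore] -/
theorem sum_stencil_sum_eq (L : ℕ) (hL : 1 ≤ L) (Y T : Finset (Site d)) (g : Site d → ℝ)
    (hg : ∀ x, x ∉ T → g x = 0) (μ ν : Fin d)
    (hY : ∀ x ∈ T, ∀ i ∈ Finset.range L, ∀ j ∈ Finset.range L,
      x - (i : ℤ) • e μ - (j : ℤ) • e ν ∈ blockSites L Y) :
    ∑ y ∈ Y, ∑ k ∈ stencilIdx d L, g ((L : ℤ) • y + stencilOff L μ ν k) = (L : ℝ) ^ 2 * ∑ x ∈ T, g x := by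
  classical
  -- flatten the stencil block by block: `Σ_y Σ_k = Σ_{x ∈ blockSites} Σ_i Σ_j g(x + ie_μ + je_ν)`
  have e1 : ∑ y ∈ Y, ∑ k ∈ stencilIdx d L, g ((L : ℤ) • y + stencilOff L μ ν k)
      = ∑ x ∈ blockSites L Y, ∑ i ∈ Finset.range L, ∑ j ∈ Finset.range L,
          g (x + (i : ℤ) • e μ + (j : ℤ) • e ν) := by
    rw [← sum_blocks_eq L hL Y (fun x => ∑ i ∈ Finset.range L, ∑ j ∈ Finset.range L,
      g (x + (i : ℤ) • e μ + (j : ℤ) • e ν))]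
    refine Finset.sum_congr rfl fun y _ => ?_
    rw [T4AveragingDeficitNonAbelian.sum_stencil_eq L g ((L : ℤ) • y) μ ν]
  have e2 : ∑ x ∈ blockSites L Y, ∑ i ∈ Finset.range L, ∑ j ∈ Finset.range L,
        g (x + (i : ℤ) • e μ + (j : ℤ) • e ν)
      = ∑ i ∈ Finset.range L, ∑ j ∈ Finset.range L, ∑ x ∈ blockSites L Y,
          g (x + (i : ℤ) • e μ + (j : ℤ) • e ν) := by
    rw [Finset.sum_comm]
    exact Finset.sum_congr rfl fun i _ => Finset.sum_comm
  rw [e1, e2]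
  have e3 : ∀ i ∈ Finset.range L, ∀ j ∈ Finset.range L,
      ∑ x ∈ blockSites L Y, g (x + (i : ℤ) • e μ + (j : ℤ) • e ν) = ∑ x ∈ T, g x := by
    intro i hi j hj
    rw [← Finset.sum_image (s := blockSites L Y) (g := fun x => x + (i : ℤ) • e μ + (j : ℤ) • e ν) (f := g)
      (fun x _ x' _ h => by simpa using h)]
    -- both sides are the sum of `g` over its support `T`, which lies in the image
    symm
    apply Finset.sum_subset_zero_on_sdiff
    · intro x hx
      refine Finset.mem_image.mpr ⟨x - (i : ℤ) • e μ - (j : ℤ) • e ν, hY x hx i hi j hj, ?_⟩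
      abel
    · intro z hz
      exact hg z (Finset.mem_sdiff.mp hz).2
    · intro _ _; rfl
  calc _ = ∑ _i ∈ Finset.range L, ∑ _j ∈ Finset.range L, ∑ x ∈ T, g x :=
        Finset.sum_congr rfl fun i hi => Finset.sum_congr rfl fun j hj => e3 i hi j hj
    _ = (L : ℝ) ^ 2 * ∑ x ∈ T, g x := by
        rw [Finset.sum_const, Finset.sum_const, Finset.card_range, nsmul_eq_mul, nsmul_eq_mul]; ring

end

end Summit.QuantumFields.BalabanUV.T4Continuum.AveragingDeficitCounting
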